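import Summits.KontsevichZagierPeriods.Zeta5Search.Barrier.ConeGammaLemmaF

/-!
# ζ(5) search — BARRIER: WINDOWED LEMMA F — per-window separable majorants bound `Φ` (the memo's (R4) schema)

HONEST FRAMING (cell `pub-zeta5`): systematic search; no irrationality claim unless kernel-certified. MODEL objects under
Brown–Zudilin's (28)+(30) accounting ([BZ22] = arXiv:2210.03391; (28) observed, not proved): an explicit UPPER-BOUND
SCHEMA for BZ's MODEL saving rate `Φ = phi30`, obtained by integrating, window by window along the flow `u ↦ u·s(a)`,
separable majorants of the saving exponent `N_a(u)`. Nothing here is about any `γ` of record, the cone's supremum (C2 OPEN),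
S-E (CONJECTURED) or `ζ(5)`; no number or sentence of record moves; records in print UNMOVED. Prover P2 g24, sequel (D)
to the item «LEMMA F IN THE KERNEL» (plan INBOX l.9199; memo `cert-2/g32/SEP-MAJORANT.md` §0 (R4), §1 LEMMA F (iii)).

**WINDOWED LEMMA F (normalised, `H = 1`).** Let `a` be a direction of the closed box with all 28 forms `h_k(a) ≤ 1`, let
`1 = U₀ ≤ U₁ ≤ ⋯ ≤ U_W` be window end-points, and suppose that on each window — `(U_w, U_{w+1})` for `w < W`, `(U_W, ∞)`
for the last — off a COUNTABLE exceptional set `S`,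
`N_a(u) ≤ c_w + Σ_{m ∈ M_w} ε_{w,m}·{u·x_{w,m}}` with `0 ≤ x_{w,m}` and `Σ_m ε_{w,m} x_{w,m} = 0`. Then, with
`J(R, x) := ∫_R^{R·x} {w} w⁻² dw` (a finite-range integral of the sawtooth; `{·} = Int.fract`),
**`Φ(a) ≤ Σ_{w<W} [c_w (1/U_w − 1/U_{w+1}) − Σ_m ε_{w,m} x_{w,m} (J(U_w, x_{w,m}) − J(U_{w+1}, x_{w,m}))]
        + c_W/U_W − Σ_m ε_{W,m} x_{W,m} J(U_W, x_{W,m})`** (`phi30_le_of_sepBound_windows`).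
Every member of the 42-family (`torusN_le_sepMajorant_fract`) is valid on all of `ℝ⁸`, so any member may serve any window;
a member with a feature that is NEGATIVELY oriented along `s` enters after `{−z} = 1 − {z}` (`Int.fract_neg`, off
`z ∈ ℤ` — whence the countable set; `countable_setOf_fract_mul_eq_zero`). With one window (`W = 0`, `S = ∅`) and
features `x ≤ 1` one has `J(1, x) = ∫_1^x w·w⁻² dw = log x`, recovering `phi30_le_of_sepBound_one`. The values of such
bounds at named directions (the memo's 1.88383 at `t_rec` with nine windows; the seat's DATA estimates with the 42 integer
members) are NOT statements of this file.

* `countable_setOf_fract_mul_eq_zero` — `{u | {u·y} = 0}` is countable (`y ≠ 0`);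
* `intervalIntegrable_floorDefect`, `integral_floorDefect_Ioc_zero`, `integral_floorDefect_window`,
  `integral_floorDefect_tail` — the defect `(⌊ux⌋ − x⌊u⌋)u⁻²` integrates to `x(J(U,x) − J(V,x))` over `(U,V]` and to
  `x·J(U,x)` over `(U,∞)` (from P2 g20's `intervalIntegral_floorDefect_eq`, `integral_Ioi_floorDefect`);
* `integral_const_div_sq_window`, `integrableOn_const_div_sq_Ioi`, `integral_const_div_sq_Ioi` — `c/u²`;
* `ae_le_of_countable` — a bound off a countable set is an a.e. bound;
* **`phi30_le_of_sepBound_windows`** — WINDOWED LEMMA F.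
-/

noncomputable section

open Set MeasureTheory Filter
open scoped Topology

namespace Summit.KontsevichZagierPeriods.Zeta5Search.Barrier.ConeGamma

/-! ### Exceptional sets -/

/-- `{u | {u·y} = 0} ⊆ {n/y | n ∈ ℤ}` is countable for `y ≠ 0` (the walls of one feature along the flow). -/
theorem countable_setOf_fract_mul_eq_zero {y : ℝ} (hy : y ≠ 0) : {u : ℝ | Int.fract (u * y) = 0}.Countable := by
  refine (Set.countable_range fun n : ℤ => (n : ℝ) / y).mono fun u hu => ?_
  rw [Set.mem_setOf_eq, Int.fract, sub_eq_zero] at hu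
  refine ⟨⌊u * y⌋, ?_⟩
  show ((⌊u * y⌋ : ℤ) : ℝ) / y = u
  rw [← hu]
  field_simp

/-- A pointwise bound off a countable set, on a measurable set `s`, is an a.e. bound for `volume.restrict s`. -/
theorem ae_le_of_countable {f g : ℝ → ℝ} {s S : Set ℝ} (hs : MeasurableSet s) (hS : S.Countable)
    (h : ∀ u ∈ s, u ∉ S → f u ≤ g u) : f ≤ᵐ[volume.restrict s] g := by
  have hS0 : ∀ᵐ u ∂(volume : Measure ℝ), u ∉ S := measure_eq_zero_iff_ae_notMem.mp (hS.measure_zero volume)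
  rw [EventuallyLE, ae_restrict_iff' hs]
  filter_upwards [hS0] with u hu hus
  exact h u hus hu

/-! ### The defect on windows -/

/-- The defect integrand is interval integrable on `[0, R]` (`x, R ≥ 0`). -/
theorem intervalIntegrable_floorDefect {x R : ℝ} (hx : 0 ≤ x) (hR : 0 ≤ R) :
    IntervalIntegrable (fun u : ℝ => ((⌊u * x⌋ : ℝ) - x * ⌊u⌋) / u ^ 2) volume 0 R := by
  have h1 := intervalIntegrable_floor_mul_div_sq hx hR
  have h2 := (intervalIntegrable_floor_div_sq hR).const_mul x
  refine (h1.sub h2).congr fun u _ => ?_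
  simp only [sub_div, mul_div_assoc]

/-- `∫₀^R` of the defect vanishes for `x = 0`, and in general equals `x log x − x·J(R,x)` for `R > 0`
(`J(R,x) = ∫_R^{Rx} {w}w⁻² dw`; for `x = 0` both sides are `0`). -/
theorem integral_floorDefect_Ioc_zero {x R : ℝ} (hx : 0 ≤ x) (hR : 0 < R) :
    ∫ u in (0 : ℝ)..R, ((⌊u * x⌋ : ℝ) - x * ⌊u⌋) / u ^ 2
      = x * Real.log x - x * ∫ w in R..(R * x), Int.fract w / w ^ 2 := by
  rcases hx.eq_or_lt with h | hx0
  · subst h; simp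
  · exact intervalIntegral_floorDefect_eq hx0 hR

/-- **The defect on a finite window**: for `x ≥ 0` and `0 < U ≤ V`,
`∫_U^V (⌊ux⌋ − x⌊u⌋) u⁻² du = x·(J(U,x) − J(V,x))`. -/
theorem integral_floorDefect_window {x U V : ℝ} (hx : 0 ≤ x) (hU : 0 < U) (hUV : U ≤ V) :
    ∫ u in U..V, ((⌊u * x⌋ : ℝ) - x * ⌊u⌋) / u ^ 2
      = x * ((∫ w in U..(U * x), Int.fract w / w ^ 2) - ∫ w in V..(V * x), Int.fract w / w ^ 2) := by
  have hV : 0 < V := hU.trans_le hUV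
  rw [← intervalIntegral.integral_interval_sub_left (intervalIntegrable_floorDefect hx hV.le)
    (intervalIntegrable_floorDefect hx hU.le), integral_floorDefect_Ioc_zero hx hV, integral_floorDefect_Ioc_zero hx hU]
  ring

/-- **The defect on the last window**: for `x ≥ 0` and `U > 0`, `∫_{(U,∞)} (⌊ux⌋ − x⌊u⌋) u⁻² du = x·J(U,x)`. -/
theorem integral_floorDefect_tail {x U : ℝ} (hx : 0 ≤ x) (hU : 0 < U) :
    ∫ u in Ioi U, ((⌊u * x⌋ : ℝ) - x * ⌊u⌋) / u ^ 2 = x * ∫ w in U..(U * x), Int.fract w / w ^ 2 := by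
  have hint := integrableOn_floorDefect hx
  have hsplit : Ioi (0 : ℝ) = Ioc 0 U ∪ Ioi U := (Ioc_union_Ioi_eq_Ioi hU.le).symm
  have hall := integral_Ioi_floorDefect hx
  rw [hsplit, setIntegral_union (Ioc_disjoint_Ioi le_rfl) measurableSet_Ioi (hint.mono_set Ioc_subset_Ioi_self)
    (hint.mono_set (Ioi_subset_Ioi hU.le)), ← intervalIntegral.integral_of_le hU.le,
    integral_floorDefect_Ioc_zero hx hU] at hall
  linarith

/-! ### `c/u²` on windows -/

/-- `∫_U^V c u⁻² du = c (1/U − 1/V)` for `0 < U ≤ V`. -/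
theorem integral_const_div_sq_window (c : ℝ) {U V : ℝ} (hU : 0 < U) (hUV : U ≤ V) :
    ∫ u in U..V, c / u ^ 2 = c * (1 / U - 1 / V) := by
  have hderiv : ∀ u ∈ uIcc U V, HasDerivAt (fun u : ℝ => -c * u⁻¹) (c / u ^ 2) u := by
    intro u hu
    rw [uIcc_of_le hUV] at hu
    have hu0 : u ≠ 0 := (hU.trans_le hu.1).ne'
    have h := (hasDerivAt_inv hu0).const_mul (-c)
    refine h.congr_deriv ?_
    rw [neg_mul_neg, div_eq_mul_inv]
  have hint : IntervalIntegrable (fun u : ℝ => c / u ^ 2) volume U V := by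
    refine ContinuousOn.intervalIntegrable ?_
    refine continuousOn_of_forall_continuousAt fun u hu => ?_
    rw [uIcc_of_le hUV] at hu
    have hu0 : u ≠ 0 := (hU.trans_le hu.1).ne'
    exact continuousAt_const.div ((continuous_pow 2).continuousAt) (pow_ne_zero 2 hu0)
  rw [intervalIntegral.integral_eq_sub_of_hasDerivAt hderiv hint]
  have hV0 : V ≠ 0 := (hU.trans_le hUV).ne'
  field_simp
  ring

/-- `u ↦ c/u²` is integrable on `(U, ∞)` for `U > 0`. -/
theorem integrableOn_const_div_sq_Ioi (c : ℝ) {U : ℝ} (hU : 0 < U) :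
    IntegrableOn (fun u : ℝ => c / u ^ 2) (Ioi U) := by
  have heq : EqOn (fun u : ℝ => c * u ^ (-2 : ℝ)) (fun u : ℝ => c / u ^ 2) (Ioi U) := by
    intro u hu
    have hu0 : 0 ≤ u := hU.le.trans (le_of_lt hu)
    simp only [Real.rpow_neg hu0, Real.rpow_two, div_eq_mul_inv]
  have hint : IntegrableOn (fun u : ℝ => c * u ^ (-2 : ℝ)) (Ioi U) :=
    (integrableOn_Ioi_rpow_of_lt (by norm_num : (-2 : ℝ) < -1) hU).const_mul c
  exact hint.congr_fun heq measurableSet_Ioi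

/-- `∫_{(U,∞)} c u⁻² du = c/U` for `U > 0`. -/
theorem integral_const_div_sq_Ioi (c : ℝ) {U : ℝ} (hU : 0 < U) : ∫ u in Ioi U, c / u ^ 2 = c / U := by
  have heq : EqOn (fun u : ℝ => c * u ^ (-2 : ℝ)) (fun u : ℝ => c / u ^ 2) (Ioi U) := by
    intro u hu
    have hu0 : 0 ≤ u := hU.le.trans (le_of_lt hu)
    simp only [Real.rpow_neg hu0, Real.rpow_two, div_eq_mul_inv]
  rw [← setIntegral_congr_fun measurableSet_Ioi heq, integral_const_mul,
    integral_Ioi_rpow_of_lt (by norm_num : (-2 : ℝ) < -1) hU]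
  have : U ^ ((-2 : ℝ) + 1) = U⁻¹ := by
    rw [show (-2 : ℝ) + 1 = -1 by norm_num, Real.rpow_neg_one]
  rw [this]
  field_simp
  norm_num

/-! ### WINDOWED LEMMA F -/

/-- **WINDOWED LEMMA F (cert-2 g32's (R4) schema), normalised form `H = 1`.** For `a` in the closed box with all 28 forms
`h_k(a) ≤ 1`, window end-points `1 = U₀ ≤ U₁ ≤ ⋯ ≤ U_W`, and on each window (`(U_w, U_{w+1})` for `w < W`, `(U_W, ∞)`)
an oriented separable bound `N_a(u) ≤ c_w + Σ_{m∈M_w} ε_{w,m}{u x_{w,m}}` (`0 ≤ x_{w,m}`, `Σ_m ε_{w,m} x_{w,m} = 0`; no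
upper bound on the features is needed) valid off a countable set `S`:
`Φ(a) ≤ Σ_{w<W} [c_w(1/U_w − 1/U_{w+1}) − Σ_m ε_{w,m} x_{w,m} (J(U_w,x_{w,m}) − J(U_{w+1},x_{w,m}))]
 + c_W/U_W − Σ_m ε_{W,m} x_{W,m} J(U_W, x_{W,m})`, `J(R,x) = ∫_R^{Rx} {w} w⁻² dw`. -/
theorem phi30_le_of_sepBound_windows {a : Dir} (ha : BZBox a) (hh : ∀ k : Fin 28, h28 a k ≤ 1)
    {ι : Type*} (W : ℕ) (U : ℕ → ℝ) (hU0 : U 0 = 1) (hU : ∀ w < W, U w ≤ U (w + 1))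
    (M : ℕ → Finset ι) (ε x : ℕ → ι → ℝ) (c : ℕ → ℝ)
    (hx0 : ∀ w ≤ W, ∀ m ∈ M w, 0 ≤ x w m)
    (hlin : ∀ w ≤ W, ∑ m ∈ M w, ε w m * x w m = 0) {S : Set ℝ} (hS : S.Countable)
    (hN : ∀ w < W, ∀ u ∈ Ioo (U w) (U (w + 1)), u ∉ S →
      (savingN a u : ℝ) ≤ c w + ∑ m ∈ M w, ε w m * Int.fract (u * x w m))
    (hNW : ∀ u ∈ Ioi (U W), u ∉ S → (savingN a u : ℝ) ≤ c W + ∑ m ∈ M W, ε W m * Int.fract (u * x W m)) :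
    phi30 a ≤
      (∑ w ∈ Finset.range W, (c w * (1 / U w - 1 / U (w + 1))
        - ∑ m ∈ M w, ε w m * (x w m * ((∫ v in (U w)..(U w * x w m), Int.fract v / v ^ 2)
            - ∫ v in (U (w + 1))..(U (w + 1) * x w m), Int.fract v / v ^ 2))))
      + (c W / U W - ∑ m ∈ M W, ε W m * (x W m * ∫ v in (U W)..(U W * x W m), Int.fract v / v ^ 2)) := by
  -- end-points are `≥ 1`
  have hU1 : ∀ w ≤ W, 1 ≤ U w := by
    intro w hw
    induction w with
    | zero => rw [hU0]
    | succ w ih => exact (ih (Nat.le_of_succ_le hw)).trans (hU w (Nat.lt_of_succ_le hw))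
  have hUpos : ∀ w ≤ W, 0 < U w := fun w hw => zero_lt_one.trans_le (hU1 w hw)
  -- the integrand and the per-window majorants
  set f : ℝ → ℝ := fun u => (savingN a u : ℝ) / u ^ 2 with hf
  have hfint : IntegrableOn f (Ioi 0) := integrableOn_savingN_div_sq ha
  set D : ℕ → ι → ℝ → ℝ := fun w m u => ((⌊u * x w m⌋ : ℝ) - x w m * ⌊u⌋) / u ^ 2 with hD
  set g : ℕ → ℝ → ℝ := fun w u => c w / u ^ 2 - ∑ m ∈ M w, ε w m * D w m u with hg
  -- pointwise: off `S`, on window `w`, `f ≤ g_w`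
  have hpt : ∀ w ≤ W, ∀ u, 0 < u → u ∉ S →
      ((savingN a u : ℝ) ≤ c w + ∑ m ∈ M w, ε w m * Int.fract (u * x w m)) → f u ≤ g w u := by
    intro w hw u hu0 _ hb
    have h := div_le_div_of_nonneg_right hb (sq_nonneg u)
    rw [sepBound_eq_defect (M w) (ε w) (x w) (c w) (hlin w hw) u, sub_div, Finset.sum_div] at h
    simpa only [hf, hg, hD, mul_div_assoc] using h
  -- `Φ = ∫_{(1,∞)} f = ∫_1^{U_W} f + ∫_{(U_W,∞)} f`
  have hphi : phi30 a = ∫ u in Ioi (1 : ℝ), f u := by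
    unfold phi30
    refine setIntegral_Ioi_eq_Ioi_one hfint fun u hu => ?_
    have hk : ∀ k : Fin 28, u * h28 a k < 1 := fun k =>
      lt_of_le_of_lt (mul_le_of_le_one_right hu.1.le (hh k)) hu.2
    show (savingN a u : ℝ) / u ^ 2 = 0
    rw [savingN_eq_zero_of_forall_lt_one ha hu.1.le hk, Int.cast_zero, zero_div]
  have hUW := hU1 W le_rfl
  have hsplit : ∫ u in Ioi (1 : ℝ), f u = (∫ u in (1 : ℝ)..U W, f u) + ∫ u in Ioi (U W), f u := by
    rw [← Ioc_union_Ioi_eq_Ioi hUW, setIntegral_union (Ioc_disjoint_Ioi le_rfl) measurableSet_Ioi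
      (hfint.mono_set (Ioc_subset_Ioi_self.trans (Ioi_subset_Ioi zero_le_one)))
      (hfint.mono_set (Ioi_subset_Ioi (zero_le_one.trans hUW))), intervalIntegral.integral_of_le hUW]
  -- the finite windows
  have hfwin : ∀ w < W, IntervalIntegrable f volume (U w) (U (w + 1)) := by
    intro w hw
    rw [intervalIntegrable_iff_integrableOn_Ioc_of_le (hU w hw)]
    exact hfint.mono_set (Ioc_subset_Ioi_self.trans (Ioi_subset_Ioi (hUpos w hw.le).le))
  have hDwin : ∀ w ≤ W, ∀ m ∈ M w, ∀ {A B : ℝ}, 0 < A → A ≤ B → IntervalIntegrable (D w m) volume A B := by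
    intro w hw m hm A B hA hAB
    rw [intervalIntegrable_iff_integrableOn_Ioc_of_le hAB]
    exact (integrableOn_floorDefect (hx0 w hw m hm)).mono_set (Ioc_subset_Ioi_self.trans (Ioi_subset_Ioi hA.le))
  have hcwin : ∀ w < W, IntervalIntegrable (fun u : ℝ => c w / u ^ 2) volume (U w) (U (w + 1)) := by
    intro w hw
    rw [intervalIntegrable_iff_integrableOn_Ioc_of_le (hU w hw)]
    exact (integrableOn_const_div_sq_Ioi (c w) (hUpos w hw.le)).mono_set Ioc_subset_Ioi_self
  have hgwin : ∀ w < W, IntervalIntegrable (g w) volume (U w) (U (w + 1)) := by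
    intro w hw
    have hs : IntervalIntegrable (fun u : ℝ => ∑ m ∈ M w, ε w m * D w m u) volume (U w) (U (w + 1)) := by
      rw [intervalIntegrable_iff_integrableOn_Ioc_of_le (hU w hw)]
      exact integrable_finsetSum (M w) fun m hm => (((integrableOn_floorDefect (hx0 w hw.le m hm)).mono_set
        (Ioc_subset_Ioi_self.trans (Ioi_subset_Ioi (hUpos w hw.le).le))).const_mul (ε w m))
    exact (hcwin w hw).sub hs
  have hwin : ∀ w < W, ∫ u in (U w)..(U (w + 1)), f u ≤
      c w * (1 / U w - 1 / U (w + 1)) - ∑ m ∈ M w, ε w m * (x w m *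
        ((∫ v in (U w)..(U w * x w m), Int.fract v / v ^ 2)
          - ∫ v in (U (w + 1))..(U (w + 1) * x w m), Int.fract v / v ^ 2)) := by
    intro w hw
    have hle : ∫ u in (U w)..(U (w + 1)), f u ≤ ∫ u in (U w)..(U (w + 1)), g w u := by
      refine intervalIntegral.integral_mono_ae_restrict (hU w hw) (hfwin w hw) (hgwin w hw) ?_
      refine ae_le_of_countable measurableSet_Icc (hS.union ((Set.countable_singleton (U w)).union
        (Set.countable_singleton (U (w + 1))))) fun u hu hus => ?_
      simp only [Set.mem_union, Set.mem_singleton_iff, not_or] at hus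
      have hu' : u ∈ Ioo (U w) (U (w + 1)) :=
        ⟨lt_of_le_of_ne hu.1 (Ne.symm hus.2.1), lt_of_le_of_ne hu.2 hus.2.2⟩
      exact hpt w hw.le u ((hUpos w hw.le).trans hu'.1) hus.1 (hN w hw u hu' hus.1)
    refine hle.trans (le_of_eq ?_)
    have hs : IntervalIntegrable (fun u : ℝ => ∑ m ∈ M w, ε w m * D w m u) volume (U w) (U (w + 1)) := by
      rw [intervalIntegrable_iff_integrableOn_Ioc_of_le (hU w hw)]
      exact integrable_finsetSum (M w) fun m hm => (((integrableOn_floorDefect (hx0 w hw.le m hm)).mono_set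
        (Ioc_subset_Ioi_self.trans (Ioi_subset_Ioi (hUpos w hw.le).le))).const_mul (ε w m))
    simp only [hg]
    rw [intervalIntegral.integral_sub (hcwin w hw) hs, integral_const_div_sq_window (c w) (hUpos w hw.le) (hU w hw),
      intervalIntegral.integral_finsetSum fun m hm => (hDwin w hw.le m hm (hUpos w hw.le) (hU w hw)).const_mul (ε w m)]
    congr 1
    refine Finset.sum_congr rfl fun m hm => ?_
    rw [intervalIntegral.integral_const_mul, hD]
    simp only
    rw [integral_floorDefect_window (hx0 w hw.le m hm) (hUpos w hw.le) (hU w hw)]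
  -- the last window
  have hlast : ∫ u in Ioi (U W), f u ≤
      c W / U W - ∑ m ∈ M W, ε W m * (x W m * ∫ v in (U W)..(U W * x W m), Int.fract v / v ^ 2) := by
    have hUW0 := hUpos W le_rfl
    have hcI := integrableOn_const_div_sq_Ioi (c W) hUW0
    have hDI : ∀ m ∈ M W, IntegrableOn (D W m) (Ioi (U W)) := fun m hm =>
      (integrableOn_floorDefect (hx0 W le_rfl m hm)).mono_set (Ioi_subset_Ioi hUW0.le)
    have hsI : IntegrableOn (fun u : ℝ => ∑ m ∈ M W, ε W m * D W m u) (Ioi (U W)) :=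
      integrable_finsetSum (M W) fun m hm => (hDI m hm).const_mul (ε W m)
    have hle : ∫ u in Ioi (U W), f u ≤ ∫ u in Ioi (U W), g W u := by
      refine setIntegral_mono_ae_restrict (hfint.mono_set (Ioi_subset_Ioi hUW0.le)) (hcI.sub hsI) ?_
      refine ae_le_of_countable measurableSet_Ioi hS fun u hu hus => ?_
      exact hpt W le_rfl u (hUW0.trans hu) hus (hNW u hu hus)
    refine hle.trans (le_of_eq ?_)
    simp only [hg]
    rw [integral_sub hcI hsI, integral_const_div_sq_Ioi (c W) hUW0,
      integral_finsetSum (M W) fun m hm => (hDI m hm).const_mul (ε W m)]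
    congr 1
    refine Finset.sum_congr rfl fun m hm => ?_
    rw [integral_const_mul, hD]
    simp only
    rw [integral_floorDefect_tail (hx0 W le_rfl m hm) hUW0]
  -- assemble
  have hadj := intervalIntegral.sum_integral_adjacent_intervals hfwin
  rw [hU0] at hadj
  rw [hphi, hsplit, ← hadj]
  have hsum := Finset.sum_le_sum fun w hw => hwin w (Finset.mem_range.mp hw)
  linarith

end Summit.KontsevichZagierPeriods.Zeta5Search.Barrier.ConeGamma

end
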